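import Mathlib.Analysis.SpecialFunctions.Log.Base
import Mathlib.Analysis.SpecialFunctions.Pow.Real
import Mathlib.Data.Nat.Log
import Literature.Computability.AlgebraicComplexity.MatrixMultiplicationExponent
import Literature.Computability.AlgebraicComplexity.TensorRankFacts
import Literature.Computability.AlgebraicComplexity.FlatteningBound
import Literature.Computability.AlgebraicComplexity.KroneckerRank
import HarnessLib

/-!
# Discharge of the named facts of `TensorRankFacts.lean` (Bläser 2013, Lemma 5.4 / Thm. 5.9)

Topic `Literature/Computability/AlgebraicComplexity`. This sibling file of `TensorRankFacts.lean`
PROVES the two named facts of that file not already discharged in `KroneckerRank.lean`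
(`Blaser2013RankSubmult_holds` lives there):

* `Blaser2013RankMonotone_holds : Blaser2013RankMonotone` — `n ≤ m → R(⟨n,n,n⟩) ≤ R(⟨m,m,m⟩)`,
  by zero-padding: `⟨n,n,n⟩` is the restriction of `⟨m,m,m⟩` along the coordinate embeddings
  `Fin n ↪ Fin m` (Bläser 2013, Lemma 5.4 `R((A ⊗ B ⊗ C)t) ≤ R(t)`, here for coordinate maps:
  `tensorRank_precomp_le`).
* `Blaser2013Thm59_holds : Blaser2013Thm59` — **Bläser 2013, Thm. 5.9** (p. 24): "If
  `R(⟨k, m, n⟩) ≤ r`, then `ω ≤ 3 · log_{kmn} r`."  The proof is the printed one: by Lemma 5.5,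
  `R(⟨n,k,m⟩) = R(⟨m,n,k⟩) = R(⟨k,m,n⟩) ≤ r`; by Lemma 5.8 and p. 24
  (`⟨k,m,n⟩ ⊗ ⟨k',m',n'⟩ ≅ ⟨kk',mm',nn'⟩`), `R(⟨kmn, kmn, kmn⟩) ≤ r³`
  (`Blaser2013_rank_matMulTensor_cube_le`); with `N = kmn`, `R(⟨Nⁱ,Nⁱ,Nⁱ⟩) ≤ r^{3i} =
  (Nⁱ)^{3 log_N r}` for all `i` (`Blaser2013_rank_matMulTensor_pow_le`); "therefore
  `ω ≤ 3 log_N r`" — the interpolation from powers of `N` to all `n` (monotonicity, choosing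
  `Nⁱ⁻¹ ≤ n < Nⁱ`, constant `r³`) is `Blaser2013_logb_mem_admissibleExponents`, and
  `ω = inf` of the admissible exponents is a genuine infimum by `admissibleExponents_bddBelow`
  (`FlatteningBound.lean`).  The case `r = 0` is vacuous since `R(⟨N,N,N⟩) ≥ N² ≥ 4`.
  The argument is universe-polymorphic: `omega_le_three_mul_logb_of_tensorRank_le` is Thm. 5.9 for a
  field `K : Type u` in any universe (the named fact `Blaser2013Thm59` quantifies over `K : Type`
  only, and its discharge is the specialisation `u = 0`).

## References

* M. Bläser, *Fast Matrix Multiplication*, Theory of Computing Library, Graduate Surveys 5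
  (2013), 1–60, doi:10.4086/toc.gs.2013.005 (held: `paper:doi-10-4086-toc-gs-2013-005`):
  Lemma 5.4 (p. 21), Lemma 5.5 (p. 22), Lemma 5.8 (p. 23), p. 24, Thm. 5.9 (p. 24). [Blaser2013]
-/

noncomputable section

open scoped BigOperators
open Filter Asymptotics

namespace Literature.Computability.AlgebraicComplexity

universe u

/-! ## Restriction along coordinate maps (Lemma 5.4 for coordinate maps) -/

section Restrict

variable {K : Type u} [CommSemiring K] {ι κ μ ι' κ' μ' : Type*}

/-- **Restriction along index maps does not increase the rank** (finite index types): for maps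
`f, g, h` on the three index sets, `R(t ∘ (f × g × h)) ≤ R(t)` — Bläser 2013, Lemma 5.4
`R((A ⊗ B ⊗ C) t) ≤ R(t)` for the coordinate homomorphisms `A = f^*`, `B = g^*`, `C = h^*`
(each triad `w ⊗ u ⊗ v` restricts to the triad `(w ∘ f) ⊗ (u ∘ g) ⊗ (v ∘ h)`).
[cite: Blaser2013, Lemma 5.4] -/
theorem tensorRank_precomp_le [Fintype ι] [Fintype κ] [Fintype μ] (t : ι → κ → μ → K)
    (f : ι' → ι) (g : κ' → κ) (h : μ' → μ) :
    tensorRank (fun a b c => t (f a) (g b) (h c)) ≤ tensorRank t := by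
  obtain ⟨w, u, v, e⟩ := exists_triad_decomposition_tensorRank t
  refine tensorRank_le_of_eq_sum (fun i a => w i (f a)) (fun i b => u i (g b))
    (fun i c => v i (h c)) ?_
  funext a b c
  conv_lhs => rw [e]
  rw [sum_triad_apply, sum_triad_apply]

end Restrict

/-! ## Matrix multiplication tensors: monotonicity, cube, powers -/

section MatMul

variable (K : Type u) [CommSemiring K]

/-- Zero-padding: for `n ≤ m`, `⟨n,n,n⟩` is the restriction of `⟨m,m,m⟩` along the coordinate
embeddings `Fin n ↪ Fin m` (Bläser 2013, Def. 7.2 / Lemma 5.4). [cite: Blaser2013, Lemma 5.4] -/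
theorem matMulTensor_eq_precomp_castLE {n m : ℕ} (h : n ≤ m) :
    matMulTensor K n n n = fun a b c =>
      matMulTensor K m m m (Prod.map (Fin.castLE h) (Fin.castLE h) a)
        (Prod.map (Fin.castLE h) (Fin.castLE h) b) (Prod.map (Fin.castLE h) (Fin.castLE h) c) := by
  funext a b c
  simp [matMulTensor, Prod.map, Fin.ext_iff]

/-- **Monotonicity of `R(⟨n,n,n⟩)` in `n`** over any commutative semiring: `n ≤ m →
R(⟨n,n,n⟩) ≤ R(⟨m,m,m⟩)` (Bläser 2013, Lemma 5.4 applied to the coordinate projections).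
[cite: Blaser2013, Lemma 5.4] -/
theorem Blaser2013_rank_matMulTensor_mono {n m : ℕ} (h : n ≤ m) :
    tensorRank (matMulTensor K n n n) ≤ tensorRank (matMulTensor K m m m) := by
  rw [matMulTensor_eq_precomp_castLE K h]
  exact tensorRank_precomp_le _ _ _ _

/-- **`R(⟨kmn, kmn, kmn⟩) ≤ R(⟨k,m,n⟩)³`** (Bläser 2013, proof of Thm. 5.9, p. 24:
`R(⟨k,m,n⟩ ⊗ ⟨n,k,m⟩ ⊗ ⟨m,n,k⟩) ≤ r³` and `⟨k,m,n⟩ ⊗ ⟨n,k,m⟩ ⊗ ⟨m,n,k⟩ = ⟨kmn,kmn,kmn⟩`, using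
Lemma 5.5 and Lemma 5.8). [cite: Blaser2013, Thm. 5.9 (proof, p. 24)] -/
theorem Blaser2013_rank_matMulTensor_cube_le (k m n : ℕ) :
    tensorRank (matMulTensor K (k * m * n) (k * m * n) (k * m * n)) ≤
      tensorRank (matMulTensor K k m n) ^ 3 := by
  -- `R(⟨kn, mk, nm⟩) ≤ R(⟨k,m,n⟩) R(⟨n,k,m⟩)`
  have h1 := Blaser2013_rank_matMulTensor_mul_le K k m n n k m
  -- `R(⟨knm, mkn, nmk⟩) ≤ R(⟨kn, mk, nm⟩) R(⟨m,n,k⟩)`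
  have h2 := Blaser2013_rank_matMulTensor_mul_le K (k * n) (m * k) (n * m) m n k
  obtain ⟨e1, e2, -⟩ := Blaser2013_lemma55 K k m n
  have ha : k * n * m = k * m * n := by ring
  have hb : m * k * n = k * m * n := by ring
  have hc : n * m * k = k * m * n := by ring
  rw [ha, hb, hc] at h2
  calc tensorRank (matMulTensor K (k * m * n) (k * m * n) (k * m * n))
      ≤ tensorRank (matMulTensor K (k * n) (m * k) (n * m)) * tensorRank (matMulTensor K m n k) := h2
    _ ≤ tensorRank (matMulTensor K k m n) * tensorRank (matMulTensor K n k m) *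
          tensorRank (matMulTensor K m n k) := Nat.mul_le_mul_right _ h1
    _ = tensorRank (matMulTensor K k m n) ^ 3 := by rw [← e1, ← e2]; ring

/-- **`R(⟨Nⁱ, Nⁱ, Nⁱ⟩) ≤ R(⟨N,N,N⟩)ⁱ`** (Bläser 2013, proof of Thm. 5.9, p. 24: "with `N = kmn`,
`R(⟨Nⁱ,Nⁱ,Nⁱ⟩) ≤ r^{3i}`", iterating Lemma 5.8 with p. 24). [cite: Blaser2013, Thm. 5.9 (proof, p. 24)] -/
theorem Blaser2013_rank_matMulTensor_pow_le (N i : ℕ) :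
    tensorRank (matMulTensor K (N ^ i) (N ^ i) (N ^ i)) ≤ tensorRank (matMulTensor K N N N) ^ i := by
  induction i with
  | zero => simpa using tensorRank_matMulTensor_le K 1 1 1
  | succ i ih =>
    rw [pow_succ, pow_succ]
    exact (Blaser2013_rank_matMulTensor_mul_le K (N ^ i) (N ^ i) (N ^ i) N N N).trans
      (Nat.mul_le_mul_right _ ih)

end MatMul

/-! ## From a rank bound in one format to an admissible exponent -/

section Omega

variable (K : Type u) [Field K]

/-- **Interpolation step of Bläser 2013, Thm. 5.9**: if `R(⟨N,N,N⟩) ≤ q` with `N ≥ 2`, `q ≥ 1`,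
then `log_N q` is an admissible exponent, indeed `R(⟨n,n,n⟩) ≤ q · n^{log_N q}` for all `n ≥ 1`
(choose `i` with `Nⁱ⁻¹ ≤ n < Nⁱ`; then `R(⟨n,n,n⟩) ≤ R(⟨Nⁱ,Nⁱ,Nⁱ⟩) ≤ qⁱ = (Nⁱ)^{log_N q} ≤
(Nn)^{log_N q} = q · n^{log_N q}` by monotonicity and `Blaser2013_rank_matMulTensor_pow_le`).
[cite: Blaser2013, Thm. 5.9 (proof, p. 24)] -/
theorem Blaser2013_logb_mem_admissibleExponents {N q : ℕ} (hN : 1 < N) (hq : 1 ≤ q)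
    (h : tensorRank (matMulTensor K N N N) ≤ q) :
    Real.logb N q ∈ admissibleExponents K := by
  set β : ℝ := Real.logb N q with hβ
  have hN0 : (0 : ℝ) < N := by exact_mod_cast (zero_lt_one.trans hN)
  have hN1 : (1 : ℝ) < N := by exact_mod_cast hN
  have hq0 : (0 : ℝ) < q := by exact_mod_cast hq
  have hβ0 : 0 ≤ β := Real.logb_nonneg hN1 (by exact_mod_cast hq)
  have hNβ : (N : ℝ) ^ β = q := Real.rpow_logb hN0 hN1.ne' hq0
  refine IsBigO.of_bound (q : ℝ) ?_
  filter_upwards [eventually_ge_atTop 1] with n hn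
  set S := Nat.log N n + 1 with hS
  have hlt : n < N ^ S := Nat.lt_pow_succ_log_self hN n
  have hle : N ^ S ≤ N * n := by
    rw [hS, pow_succ, mul_comm]
    exact Nat.mul_le_mul_left N (Nat.pow_log_le_self N (by omega))
  have hnat : tensorRank (matMulTensor K n n n) ≤ q ^ S :=
    (Blaser2013_rank_matMulTensor_mono K hlt.le).trans
      ((Blaser2013_rank_matMulTensor_pow_le K N S).trans (Nat.pow_le_pow_left h S))
  have hn0 : (0 : ℝ) ≤ n := Nat.cast_nonneg _
  rw [Real.norm_of_nonneg (Nat.cast_nonneg _), Real.norm_of_nonneg (Real.rpow_nonneg hn0 _)]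
  calc (tensorRank (matMulTensor K n n n) : ℝ) ≤ (q : ℝ) ^ S := by exact_mod_cast hnat
    _ = ((N ^ S : ℕ) : ℝ) ^ β := by
      rw [Nat.cast_pow, ← hNβ, ← Real.rpow_mul_natCast hN0.le, ← Real.rpow_natCast_mul hN0.le]
      congr 1
      exact mul_comm _ _
    _ ≤ ((N * n : ℕ) : ℝ) ^ β := Real.rpow_le_rpow (Nat.cast_nonneg _) (by exact_mod_cast hle) hβ0
    _ = q * (n : ℝ) ^ β := by rw [Nat.cast_mul, Real.mul_rpow hN0.le hn0, hNβ]

/-- **Bläser 2013, Thm. 5.9**, over a field in any universe: "If `R(⟨k, m, n⟩) ≤ r`, then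
`ω ≤ 3 · log_{kmn} r`" (for `kmn > 1`). Proof as printed (p. 24): Lemma 5.5 + Lemma 5.8 give
`R(⟨N,N,N⟩) ≤ r³`, `N = kmn` (`Blaser2013_rank_matMulTensor_cube_le`), hence
`R(⟨Nⁱ,Nⁱ,Nⁱ⟩) ≤ r^{3i}` and `log_N r³ = 3 log_N r` is admissible
(`Blaser2013_logb_mem_admissibleExponents`); `ω ≤` it since the admissible exponents are bounded
below (`admissibleExponents_bddBelow`). The case `r = 0` is vacuous (`R(⟨N,N,N⟩) ≥ N²`,
`matMulTensor_sq_le_tensorRank`). The named fact `Blaser2013Thm59` is the case `K : Type`.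
[cite: Blaser2013, Thm. 5.9] -/
theorem omega_le_three_mul_logb_of_tensorRank_le (k m n r : ℕ) (hkmn : 1 < k * m * n)
    (hr : tensorRank (matMulTensor K k m n) ≤ r) :
    omega K ≤ 3 * Real.logb (k * m * n : ℕ) r := by
  have hcube : tensorRank (matMulTensor K (k * m * n) (k * m * n) (k * m * n)) ≤ r ^ 3 :=
    (Blaser2013_rank_matMulTensor_cube_le K k m n).trans (Nat.pow_le_pow_left hr 3)
  have hr1 : 1 ≤ r := by
    rcases Nat.eq_zero_or_pos r with rfl | h
    · exfalso
      have hsq := matMulTensor_sq_le_tensorRank K (k * m * n)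
      have h0 : (k * m * n) ^ 2 ≤ 0 := hsq.trans (by simpa using hcube)
      have hpos : 0 < (k * m * n) ^ 2 := pow_pos (Nat.zero_lt_of_lt hkmn) 2
      omega
    · exact h
  have hmem := Blaser2013_logb_mem_admissibleExponents K hkmn (Nat.one_le_pow _ _ hr1) hcube
  have hlog : Real.logb ((k * m * n : ℕ) : ℝ) ((r ^ 3 : ℕ) : ℝ) =
      3 * Real.logb ((k * m * n : ℕ) : ℝ) (r : ℝ) := by
    rw [Nat.cast_pow, Real.logb_pow]
    push_cast
    ring
  rw [hlog] at hmem
  exact csInf_le (admissibleExponents_bddBelow K) hmem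

end Omega

/-! ## Discharges -/

/-- DISCHARGE of the named fact `Blaser2013RankMonotone` (`TensorRankFacts.lean`):
`n ≤ m → R(⟨n,n,n⟩) ≤ R(⟨m,m,m⟩)` over every field. [cite: Blaser2013, Lemma 5.4] -/
theorem Blaser2013RankMonotone_holds : Blaser2013RankMonotone :=
  fun K _ _ _ h => Blaser2013_rank_matMulTensor_mono K h

/-- DISCHARGE of the named fact `Blaser2013Thm59` (`TensorRankFacts.lean`) — **Bläser 2013,
Thm. 5.9**: "If `R(⟨k, m, n⟩) ≤ r`, then `ω ≤ 3 · log_{kmn} r`" (for `kmn > 1`, over every field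
`K : Type`): the universe-`0` case of `omega_le_three_mul_logb_of_tensorRank_le`.
[cite: Blaser2013, Thm. 5.9] -/
theorem Blaser2013Thm59_holds : Blaser2013Thm59 :=
  fun K _ k m n r hkmn hr => omega_le_three_mul_logb_of_tensorRank_le K k m n r hkmn hr

end Literature.Computability.AlgebraicComplexity

end
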